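import Mathlib
import Summits.Ventures.FusionMHD.Models.CerfonFreidbergIterLikeQHalfMercData
import Summits.Ventures.FusionMHD.Models.CerfonFreidbergIterLikeQHalf
import Summits.Ventures.FusionMHD.Models.CerfonFreidbergIterLikeQHalfGGJHalf
import HarnessLib

/-!
# Ventures/FusionMHD — Models/CerfonFreidbergIterLikeQHalfMercier.lean: ★ THE CERTIFIED MERCIER `F`-THRESHOLD AT `ψ_N = 1/2` OF THE Cerfon–Freidberg
# ITER-like MODEL FLUX — Jardin's (8.134) on the implicit (computed-shape) surface is `F²·M₂ − M₀` with `M₂ ∈ [82181.5, 82195.3]`, `M₀ ∈ [14970.65, 14970.74]`;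
# it HOLDS for every `|F| ≥ 0.42682` and FAILS for every `|F| ≤ 0.42677`

HONEST FRAMING (LADDER-GRIDFUSION three columns; CF rung; F2 item R2 — the booked row «F2.R2-CF-MERCIER-IMPLICIT» (lead 9bm/9cv), step (5) of
`pub/gridfusion/models/F2-SCOPING.md` v1.6 §10(c)).
* CERTIFIED (kernel, this file + its imports; axioms standard): for THE flux of record `U = cfSolution 0 coeff` of the CF ITER-like instance and the surface
  `u₀ = U(X_a, 0)/2` (`ψ_N = 1/2`, glued ray radius `ρ`, ★ #117), with Jardin's record `ggjData F u₀` of the thirteen (8.134) inputs of that IMPLICIT surface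
  (model-7 g6, `…QHalfGGJ`; `F = R B_φ` the free constant of the Solov'ev profiles):
  (§2–§3) the six registers of `mercierCriterion_half_iff_halfLoop` COLLAPSE to F-independent ones — pointwise `F²·sigmaSqKernel F + invBsqKernel F = KR`
  and `bsqGradKernel F = F²·KB + polarKernel`, hence **`registerForm_eq`**: `mercierRegisterForm F 1 Pd Wd Aσ As AB Ai = F²·M2v − M0v` with
  `M2v = (Pd + 2Aσ)² − 4·A_B1·(A_R + Wd)`, `M0v = 4·W_R·(A_R + Wd)` (`Pd` = the shear register of `…QHalfShear`, `W_R = ∫₀^π polarKernel` = ★ #117's own register,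
  `Wd, Aσ, A_R, A_B1` = `…QHalfMercData`);
  (§4) **`M2v_bounds : 82181.51 ≤ M2v ≤ 82195.30`**, **`M0v_bounds : 14970.654 ≤ M0v ≤ 14970.731`**;
  (§5) **`mercier_half_iff : (ggjData F u₀).MercierCriterion ↔ M0v/M2v < F²`**, **`mercier_half_of_ge`**: the criterion HOLDS for every `|F| ≥ 0.42682`,
  **`not_mercier_half_of_le`**: it FAILS for every `|F| ≤ 0.42677` — the CERTIFIED two-sided threshold `F_M(ψ_N = 1/2) ∈ [0.42677, 0.42682]` of THE CF
  ITER-like MODEL (cf. the certified near-axis threshold `0.5583` of the same model, `…CerfonFreidbergIterLikeAxis`, and the PCF mid-surface `0.5508`,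
  `Bench/SolovevPCFIterMercierMidThreshold`: on the CF rung the threshold DECREASES outward, as VALIDATED by model-7 g6).
* VALIDATED (never used in a proof): float `F_M(1/2) = 0.42679` (model-7 g6 `cf_registers.py`; g7 `genqm/validate.py`), inside the bracket.
* MODELLED: analytic Cerfon–Freidberg family (ideal MHD, Solov'ev profiles `A = 0`, fixed analytic boundary) [PatakiCerfonFreidberg2013]; Mercier is a NECESSARY
  local-interchange criterion of the MODEL on a MODEL surface — nothing here says ITER the device, a discharge or a plasma is stable or unstable.
Typer/prover: gridfusion-model-7 (g7), 2026-08-28.  Citations: Jardin 2010 §8.5.4 eq. (8.134) [Jardin2010]; Freidberg 2014 §6.6.1 (6.153) [Freidberg2014];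
Pataki–Cerfon–Freidberg 2013 §6.1 [PatakiCerfonFreidberg2013].
-/

noncomputable section

open Set MeasureTheory intervalIntegral
open Literature.Analysis.ValidatedNumerics Literature.Analysis.ValidatedNumerics.PolyMP
open Literature.MathematicalPhysics.MHD Literature.MathematicalPhysics.MHD.CerfonFreidberg Literature.MathematicalPhysics.MHD.GradShafranov
  Literature.MathematicalPhysics.MHD.FluxGeometry Literature.MathematicalPhysics.MHD.Mercier.FluxForm
open Summit.Ventures.FusionMHD.Models.PolarRay

set_option autoImplicit false

namespace Summit.Ventures.FusionMHD.Models.CFIterLike.QHalf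

/-! ## §1 Surface-point facts and integrability of the F-dependent kernels on `[0, π]` -/

/-- At every surface point: `X > 0`, `D_r > 0`, `G > 0`. -/
theorem surface_point {θ : ℝ} (hθ : θ ∈ Icc 0 (2 * Real.pi)) :
    0 < Xa + ρ θ * Real.cos θ ∧ 0 < Dfield θ (ρ θ) ∧ 0 < Gfield θ (ρ θ) := by
  obtain ⟨j, hj, hθj⟩ := levelLoop.exists_panel hθ
  have P := levelLoop.panel j hj
  have hρ := (P.spec u₀_mem hθj).1
  have hσ := σ_bounds hj
  have hX : 0 < Xa + ρ θ * Real.cos θ := X_pos_of_box hσ.1.le hσ.2 (Ioo_subset_Icc_self hρ)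
  have hD : 0 < Dfield θ (ρ θ) := P.slopePos θ hθj _ (Ioo_subset_Icc_self hρ)
  exact ⟨hX, hD, (pow_pos hD 2).trans_le (Dfield_sq_le_Gfield θ (ρ θ))⟩

/-- Box facts of ★ #117's 64 panels: `D ≠ 0`, `G ≠ 0`, `R ≠ 0`, `g² + G ≠ 0`, `G` jointly continuous. -/
theorem box_factsM {j : ℕ} (hj : j < 64) :
    (∀ p ∈ Icc (t64 j) (t64 (j + 1)) ×ˢ Icc (σ₁ j) (σ₂ j), Dfield p.1 p.2 ≠ 0)
    ∧ (∀ p ∈ Icc (t64 j) (t64 (j + 1)) ×ˢ Icc (σ₁ j) (σ₂ j), Gfield p.1 p.2 ≠ 0)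
    ∧ (∀ p ∈ Icc (t64 j) (t64 (j + 1)) ×ˢ Icc (σ₁ j) (σ₂ j), Xa + p.2 * Real.cos p.1 ≠ 0)
    ∧ (∀ g : ℝ, ∀ p ∈ Icc (t64 j) (t64 (j + 1)) ×ˢ Icc (σ₁ j) (σ₂ j), g ^ 2 + Gfield p.1 p.2 ≠ 0)
    ∧ ContinuousOn (fun p : ℝ × ℝ => Gfield p.1 p.2) (Icc (t64 j) (t64 (j + 1)) ×ˢ Icc (σ₁ j) (σ₂ j)) := by
  have P := levelLoop.panel j hj
  have hσ := σ_bounds hj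
  have hD : ∀ p ∈ Icc (t64 j) (t64 (j + 1)) ×ˢ Icc (σ₁ j) (σ₂ j), 0 < Dfield p.1 p.2 := fun p hp => P.slopePos p.1 hp.1 p.2 hp.2
  have hG : ∀ p ∈ Icc (t64 j) (t64 (j + 1)) ×ˢ Icc (σ₁ j) (σ₂ j), 0 < Gfield p.1 p.2 := fun p hp =>
    (pow_pos (hD p hp) 2).trans_le (Dfield_sq_le_Gfield p.1 p.2)
  refine ⟨fun p hp => (hD p hp).ne', fun p hp => (hG p hp).ne', fun p hp => (X_pos_of_box hσ.1.le hσ.2 hp.2).ne',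
    fun g p hp => (add_pos_of_nonneg_of_pos (sq_nonneg g) (hG p hp)).ne', continuousOn_Gfield_box' hσ.1 hσ.2⟩

/-- A kernel jointly continuous on each of the 32 boxes of `[0, π]` is integrable along `ρ` on `[0, π]`. -/
theorem intervalIntegrable_half {k : ℝ → ℝ → ℝ}
    (hkc : ∀ j < 32, ContinuousOn (fun p : ℝ × ℝ => k p.1 p.2) (Icc (t64 j) (t64 (j + 1)) ×ˢ Icc (σ₁ j) (σ₂ j))) :
    IntervalIntegrable (fun θ => k θ (ρ θ)) volume 0 Real.pi := by
  have hI := IntervalIntegrable.trans_iterate (a := t64) (n := 32)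
    (fun j hj => (levelPanel_lt hj).intervalIntegrable_kernel (hkc j hj) u₀_mem)
  have e0 : t64 0 = 0 := by unfold t64; simp
  have e1 : t64 32 = Real.pi := by unfold t64; push_cast; ring
  rw [e0, e1] at hI
  exact hI

/-- `sigmaSqKernel F` is integrable along `ρ` on `[0, π]`. -/
theorem integrable_sigmaSq (F : ℝ) :
    IntervalIntegrable (fun θ => sigmaSqKernel F Xa Dfield Gfield θ (ρ θ)) volume 0 Real.pi := by
  refine intervalIntegrable_half fun j hj => ?_
  obtain ⟨hD0, hG0, -, hgG, hGc⟩ := box_factsM (show j < 64 by omega)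
  exact continuousOn_sigmaSqKernel (levelPanel_lt hj).slopeCont hGc hD0 hG0 (hgG F)

/-- `invBsqKernel F` is integrable along `ρ` on `[0, π]`. -/
theorem integrable_invBsq (F : ℝ) :
    IntervalIntegrable (fun θ => invBsqKernel F Xa Dfield Gfield θ (ρ θ)) volume 0 Real.pi := by
  refine intervalIntegrable_half fun j hj => ?_
  obtain ⟨hD0, -, -, hgG, hGc⟩ := box_factsM (show j < 64 by omega)
  exact continuousOn_invBsqKernel (levelPanel_lt hj).slopeCont hGc hD0 (hgG F)

/-! ## §2 The pointwise collapse of the F-dependent kernels -/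

/-- `F²·sigmaSqKernel F + invBsqKernel F = KR` at every surface point of `[0, π]`. -/
theorem KR_split (F : ℝ) {θ : ℝ} (hθ : θ ∈ Icc 0 Real.pi) :
    F ^ 2 * sigmaSqKernel F Xa Dfield Gfield θ (ρ θ) + invBsqKernel F Xa Dfield Gfield θ (ρ θ) = KR θ (ρ θ) := by
  obtain ⟨-, hD, hG⟩ := surface_point (θ := θ) ⟨hθ.1, hθ.2.trans (by linarith [Real.pi_pos])⟩
  have hFG : F ^ 2 + Gfield θ (ρ θ) ≠ 0 := (add_pos_of_nonneg_of_pos (sq_nonneg F) hG).ne'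
  unfold sigmaSqKernel invBsqKernel KR
  field_simp

/-- `bsqGradKernel F = F²·KB + polarKernel` at every surface point of `[0, π]` (`polarKernel(θ, ρ θ) = Pq θ`, ★ #117's integrand). -/
theorem bsq_split (F : ℝ) {θ : ℝ} (hθ : θ ∈ Icc 0 Real.pi) :
    bsqGradKernel F Xa Dfield Gfield θ (ρ θ) = F ^ 2 * KB θ (ρ θ) + Pq θ := by
  obtain ⟨hX, hD, hG⟩ := surface_point (θ := θ) ⟨hθ.1, hθ.2.trans (by linarith [Real.pi_pos])⟩
  have e : Pq θ = polarKernel Xa Dfield θ (ρ θ) := rfl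
  rw [e]
  unfold bsqGradKernel KB volKernel polarKernel
  field_simp

/-! ## §3 The register identities and the quadratic form -/

/-- `F²·As + Ai = A_R` on `[0, π]`. -/
theorem AR_eq (F : ℝ) :
    F ^ 2 * (∫ θ in (0 : ℝ)..Real.pi, sigmaSqKernel F Xa Dfield Gfield θ (ρ θ)) + ∫ θ in (0 : ℝ)..Real.pi, invBsqKernel F Xa Dfield Gfield θ (ρ θ)
      = ∫ θ in (0 : ℝ)..Real.pi, KR θ (ρ θ) := by
  rw [← intervalIntegral.integral_const_mul, ← intervalIntegral.integral_add ((integrable_sigmaSq F).const_mul _) (integrable_invBsq F)]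
  refine intervalIntegral.integral_congr fun θ hθ => ?_
  rw [uIcc_of_le Real.pi_pos.le] at hθ
  exact KR_split F hθ

/-- `AB = F²·A_B1 + W_R` on `[0, π]`. -/
theorem AB_eq (F : ℝ) :
    ∫ θ in (0 : ℝ)..Real.pi, bsqGradKernel F Xa Dfield Gfield θ (ρ θ)
      = F ^ 2 * (∫ θ in (0 : ℝ)..Real.pi, KB θ (ρ θ)) + ∫ θ in (0 : ℝ)..Real.pi, Pq θ := by
  rw [← intervalIntegral.integral_const_mul, ← intervalIntegral.integral_add (mercB_half_bounds.2.2.const_mul _) half_bounds.2.2]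
  refine intervalIntegral.integral_congr fun θ hθ => ?_
  rw [uIcc_of_le Real.pi_pos.le] at hθ
  exact bsq_split F hθ

/-- **`M₂`** — the `F²`-coefficient of Jardin's function on the surface: `(Pd + 2Aσ)² − 4·A_B1·(A_R + Wd)`. -/
def M2v : ℝ :=
  ((∫ θ in (0 : ℝ)..Real.pi, polarKernelDs Xa Dfield F2field θ (ρ θ) / Dfield θ (ρ θ)) + 2 * ∫ θ in (0 : ℝ)..Real.pi, KS θ (ρ θ)) ^ 2
    - 4 * (∫ θ in (0 : ℝ)..Real.pi, KB θ (ρ θ)) * ((∫ θ in (0 : ℝ)..Real.pi, KR θ (ρ θ)) + ∫ θ in (0 : ℝ)..Real.pi, KW θ (ρ θ))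

/-- **`M₀`** — the constant term: `4·W_R·(A_R + Wd)`. -/
def M0v : ℝ := 4 * (∫ θ in (0 : ℝ)..Real.pi, Pq θ) * ((∫ θ in (0 : ℝ)..Real.pi, KR θ (ρ θ)) + ∫ θ in (0 : ℝ)..Real.pi, KW θ (ρ θ))

/-- **THE REGISTER FORM IS QUADRATIC IN `F` WITH F-INDEPENDENT REGISTERS**: `mercierRegisterForm F 1 Pd Wd Aσ As AB Ai = F²·M2v − M0v`. -/
theorem registerForm_eq (F : ℝ) :
    mercierRegisterForm F 1
      (∫ θ in (0 : ℝ)..Real.pi, polarKernelDs Xa Dfield F2field θ (ρ θ) / Dfield θ (ρ θ))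
      (∫ θ in (0 : ℝ)..Real.pi, volKernelDs Xa Dfield F2field θ (ρ θ) / Dfield θ (ρ θ))
      (∫ θ in (0 : ℝ)..Real.pi, invGradKernel Xa Dfield Gfield θ (ρ θ))
      (∫ θ in (0 : ℝ)..Real.pi, sigmaSqKernel F Xa Dfield Gfield θ (ρ θ))
      (∫ θ in (0 : ℝ)..Real.pi, bsqGradKernel F Xa Dfield Gfield θ (ρ θ))
      (∫ θ in (0 : ℝ)..Real.pi, invBsqKernel F Xa Dfield Gfield θ (ρ θ)) = F ^ 2 * M2v - M0v := by
  have hAi : ∫ θ in (0 : ℝ)..Real.pi, invBsqKernel F Xa Dfield Gfield θ (ρ θ)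
      = (∫ θ in (0 : ℝ)..Real.pi, KR θ (ρ θ)) - F ^ 2 * (∫ θ in (0 : ℝ)..Real.pi, sigmaSqKernel F Xa Dfield Gfield θ (ρ θ)) := by
    linarith [AR_eq F]
  have hW : (∫ θ in (0 : ℝ)..Real.pi, volKernelDs Xa Dfield F2field θ (ρ θ) / Dfield θ (ρ θ)) = ∫ θ in (0 : ℝ)..Real.pi, KW θ (ρ θ) := rfl
  have hS : (∫ θ in (0 : ℝ)..Real.pi, invGradKernel Xa Dfield Gfield θ (ρ θ)) = ∫ θ in (0 : ℝ)..Real.pi, KS θ (ρ θ) := rfl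
  rw [hAi, AB_eq, hW, hS]
  unfold mercierRegisterForm M2v M0v
  ring

/-- **MERCIER (8.134) AT `ψ_N = 1/2` ⟺ `0 < F²·M2v − M0v`.** -/
theorem mercier_half_iff_quadratic (F : ℝ) : (ggjData F u₀).MercierCriterion ↔ 0 < F ^ 2 * M2v - M0v := by
  rw [mercierCriterion_half_iff_halfLoop, registerForm_eq]

/-! ## §4 The certified brackets of `M₂` and `M₀` -/

/-- **`82181.51 ≤ M2v ≤ 82195.30`.** -/
theorem M2v_bounds : (8218151 / 100 : ℝ) ≤ M2v ∧ M2v ≤ (821953 / 10 : ℝ) := by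
  obtain ⟨hP1, hP2, -⟩ := shear_half_bounds
  obtain ⟨hW1, hW2, -⟩ := mercW_half_bounds
  obtain ⟨hS1, hS2, -⟩ := mercS_half_bounds
  obtain ⟨hR1, hR2, -⟩ := mercR_half_bounds
  obtain ⟨hB1, hB2, -⟩ := mercB_half_bounds
  norm_num [shearTotLo, shearTotHi, mercWLo, mercWHi, mercSLo, mercSHi, mercRLo, mercRHi, mercBLo, mercBHi] at hP1 hP2 hW1 hW2 hS1 hS2 hR1 hR2 hB1 hB2
  set Pd := ∫ θ in (0 : ℝ)..Real.pi, polarKernelDs Xa Dfield F2field θ (ρ θ) / Dfield θ (ρ θ)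
  set W := ∫ θ in (0 : ℝ)..Real.pi, KW θ (ρ θ)
  set S := ∫ θ in (0 : ℝ)..Real.pi, KS θ (ρ θ)
  set R := ∫ θ in (0 : ℝ)..Real.pi, KR θ (ρ θ)
  set B := ∫ θ in (0 : ℝ)..Real.pi, KB θ (ρ θ)
  have hsq1 : ((99686237563 / 1000000000 : ℝ) + 2 * (252456391449 / 500000000)) ^ 2 ≤ (Pd + 2 * S) ^ 2 :=
    pow_le_pow_left₀ (by norm_num) (by linarith) 2
  have hsq2 : (Pd + 2 * S) ^ 2 ≤ ((249216162433 / 2500000000 : ℝ) + 2 * (2524569784793 / 5000000000)) ^ 2 :=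
    pow_le_pow_left₀ (by linarith) (by linarith) 2
  have hpr1 : B * (R + W) ≤ (5804379338849 / 10000000000 : ℝ) * ((4672123429683 / 10000000000 : ℝ) + 138007569899 / 5000000000) :=
    mul_le_mul hB2 (by linarith) (by linarith) (by norm_num)
  have hpr2 : (580436722343 / 1000000000 : ℝ) * ((292006312473 / 625000000 : ℝ) + 276013151757 / 10000000000) ≤ B * (R + W) :=
    mul_le_mul hB1 (by linarith) (by norm_num) (by linarith)
  unfold M2v
  constructor <;> nlinarith [hsq1, hsq2, hpr1, hpr2]

/-- **`14970.654 ≤ M0v ≤ 14970.731`.** -/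
theorem M0v_bounds : (14970654 / 1000 : ℝ) ≤ M0v ∧ M0v ≤ (14970731 / 1000 : ℝ) := by
  obtain ⟨hQ1, hQ2, -⟩ := half_bounds
  obtain ⟨hW1, hW2, -⟩ := mercW_half_bounds
  obtain ⟨hR1, hR2, -⟩ := mercR_half_bounds
  norm_num [totLo, totHi, mercWLo, mercWHi, mercRLo, mercRHi] at hQ1 hQ2 hW1 hW2 hR1 hR2
  set Q := ∫ θ in (0 : ℝ)..Real.pi, Pq θ
  set W := ∫ θ in (0 : ℝ)..Real.pi, KW θ (ρ θ)
  set R := ∫ θ in (0 : ℝ)..Real.pi, KR θ (ρ θ)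
  have hpr1 : Q * (R + W) ≤ (189095481350501 / 25000000000000 : ℝ) * ((4672123429683 / 10000000000 : ℝ) + 138007569899 / 5000000000) :=
    mul_le_mul hQ2 (by linarith) (by linarith) (by norm_num)
  have hpr2 : (756381846259577 / 100000000000000 : ℝ) * ((292006312473 / 625000000 : ℝ) + 276013151757 / 10000000000) ≤ Q * (R + W) :=
    mul_le_mul hQ1 (by linarith) (by norm_num) (by linarith)
  unfold M0v
  constructor <;> nlinarith [hpr1, hpr2]

/-! ## §5 ★ The certified threshold -/

/-- **MERCIER AT `ψ_N = 1/2` ⟺ `M0v/M2v < F²`** (`M2v > 0`). -/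
theorem mercier_half_iff (F : ℝ) : (ggjData F u₀).MercierCriterion ↔ M0v / M2v < F ^ 2 := by
  rw [mercier_half_iff_quadratic]
  have hM2 : 0 < M2v := by linarith [M2v_bounds.1]
  rw [div_lt_iff₀ hM2]
  constructor <;> intro h <;> linarith

/-- **★ MERCIER HOLDS AT `ψ_N = 1/2` FOR EVERY `|F| ≥ 0.42682`** (THE CF ITER-like MODEL flux; necessary criterion of the MODEL). -/
theorem mercier_half_of_ge {F : ℝ} (hF : (21341 / 50000 : ℝ) ≤ |F|) : (ggjData F u₀).MercierCriterion := by
  rw [mercier_half_iff_quadratic]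
  have hF2 : (21341 / 50000 : ℝ) ^ 2 ≤ F ^ 2 := by rw [← sq_abs F]; exact pow_le_pow_left₀ (by norm_num) hF 2
  nlinarith [M2v_bounds.1, M2v_bounds.2, M0v_bounds.1, M0v_bounds.2, hF2]

/-- **★ MERCIER FAILS AT `ψ_N = 1/2` FOR EVERY `|F| ≤ 0.42677`.** -/
theorem not_mercier_half_of_le {F : ℝ} (hF : |F| ≤ (42677 / 100000 : ℝ)) : ¬ (ggjData F u₀).MercierCriterion := by
  rw [mercier_half_iff_quadratic, not_lt]
  have hF2 : F ^ 2 ≤ (42677 / 100000 : ℝ) ^ 2 := by rw [← sq_abs F]; exact pow_le_pow_left₀ (abs_nonneg F) hF 2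
  nlinarith [M2v_bounds.1, M2v_bounds.2, M0v_bounds.1, M0v_bounds.2, hF2, sq_nonneg F]

/-- **★ THE TWO-SIDED THRESHOLD**: `F_M(ψ_N = 1/2) ∈ [0.42677, 0.42682]` in the sense of the two theorems above (width `5·10⁻⁵`). -/
theorem mercier_half_threshold :
    (∀ F : ℝ, (21341 / 50000 : ℝ) ≤ |F| → (ggjData F u₀).MercierCriterion)
    ∧ (∀ F : ℝ, |F| ≤ (42677 / 100000 : ℝ) → ¬ (ggjData F u₀).MercierCriterion) :=
  ⟨fun _ hF => mercier_half_of_ge hF, fun _ hF => not_mercier_half_of_le hF⟩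

end Summit.Ventures.FusionMHD.Models.CFIterLike.QHalf

end
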